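import Summits.BirchSwinnertonDyer.BirchSwinnertonDyer.Theorems.SchneiderFreeSocketsV2
import Summits.BirchSwinnertonDyer.Rank1Residual.X11b.HalvesReceptacle
import Literature.NumberTheory.EllipticCurves.BDPAnticyclotomicPAdicLFunction
import HarnessLib
import HarnessLib.Audit.Tags

/-!
# Route `SchneiderFreeAdditiveX3` — objects the route posits (layer 2 of the two branch cruxes):
# the TYPED HALVES of the additive socket `AdditiveIMCLowerBDPInputManinAt`

Cell `bsd-schneider-ideate`, seat `bsd-schneider-door-c3` (prover, gen 2). Statements only: four
predicates with bodies (`BranchInducesPrime`, `BranchBDPExistsAt`, `BranchIMCDivAt`,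
`BranchBDPValueLeAt`); NOTHING is asserted about elliptic curves. HONEST FRAMING: BSD is not proved
by any of this; the cruxes `GordTwoBranchIMC` (item 19177) and `PotMultBranchIMC` (item 19176) stay
OPEN; these are the named hypotheses through which a typed pair (branch main conjecture ⊇, value at
𝟙) closes them (`Theorems/SchneiderFreeAdditiveX3BranchIMCHalves.lean`). This is the route's
announced TWO-LAYER PLAN "`GordTwoBranchIMC ⇐ KYGreenbergEquality → InterpolationMatching`" made
precise, in the pattern of team x11b3's `X11b.Three.BDPExistsAt₃ / IMCDivAt₃ / BDPValueAt₃`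
(`Rank1Residual/X11b/Three/StepLHalves.lean`), adapted to an ADDITIVE prime:

* the data are exactly the binders of the socket `SchneiderFree.AdditiveIMCLowerBDPInputManinAt W p`
  (rev 3, Manin-robust: ANY parametrisation datum `Dt`, no `p ∤ Dt.c`), the frames are the socket's
  `(κ, γ, 𝔭)` with `𝔭 ∣ p` of degree one, and the form is THE newform `Dt.f` of the datum;
* the `p`-adic `L`-function is pinned by the tree's `IsBDPLFunction ι' 𝔭 κ γ Dt.f Ω_K Ω_p L`
  (Castella 2018, Thm. 3.1 shape; at `p² ∣ N` its Euler-type factor is `1` because `a_p(f_E) = 0`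
  and `ε_p = 0`, tree `SchneiderFree.IsBDPLFunction.hasValueAt_of_addv`), with the period slot
  `Ω_p ∈ ℂ_p` left FREE (only `Ω_p ≠ 0`, `Ω_K ≠ 0`). WHY FREE: the natural candidate on the
  reducible semistable-twist cells — Keller–Yin's `𝓛_ε := 𝓛_p(f̃)(χ_ε ·) ∈ Λ^{ur}` for the Heegner
  pair `(f̃, χ_ε)`, `f_E = f̃ ⊗ ε` (arXiv:2410.23241 §3.4, p. 19) — interpolates `L(f_E/K, ξ, 1)` at
  unramified `ξ` of infinity type `(n, −n)` with Castella–Hsieh's multiplier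
  `e_𝔭(f̃, ε_K ξ) = ε(½, (ε_K ξ)_𝔭)^{-2}` (Math. Ann. 370 (2018), Def. 3.5 / Prop. 3.6 and the display
  defining `e_𝔭`, arXiv:1505.08165 pp. 10–11: "`ε(½, χ_𝔭)^{-2}` if `p ∣ c`"), which by the
  unramified-twist rule for local ε-factors is `± ξ_𝔭(p)^{-2}`, of `p`-adic size `p^{2n}` times the
  value of a fixed element of `Γ` — i.e. Castella's shape with `Ω_p` replaced by `Ω_p · p^{1/2}` (up
  to a unit of `Λ_{R₀}`); the same ε-factor shape is Liu–Zhang–Zhang's (Duke 167 (2018) Thm. 1.6,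
  arXiv:1511.08172 p. 5). A period slot restricted to `R₀ˣ` would therefore type a frame with no
  known witness (finding F3 of this seat, gen 0, now with locators);
* the value half carries an INTEGRAL cofactor `u ∈ R₀` (a lower bound needs no unit) and the Manin
  slack: `L(𝟙) = u · (log_{ω_E} P / c)²`, `c = Dt.c`.

Nothing here is a Literature fact: H1 (existence of such a frame at `p² ∣ N`) is Castella–Hsieh's
construction for `f̃` read on the `χ_ε`-branch — a derivation, not a printed statement; H3 is
Keller–Yin 2410.23241 Thm. 3.5.1 (PREPRINT) transported to the frame; H2 is the value of `𝓛_ε` at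
`𝟙` against THE datum's Heegner point `P` (not in print: Castella–Hsieh Thm. 4.8 needs conductor
`p^n`, `n ≥ 2`; Keller–Yin's Heegner class is the `χ_ε`-twisted conductor-`p` point of `Ẽ`).

References: [KellerYin2024b] arXiv:2410.23241 Def. 3.4.1, Thm. 3.4.3, Prop. 3.4.4, Thm. 3.5.1
(pp. 19–20); [CastellaHsieh2018] Def. 3.5, Prop. 3.6, Thm. 4.8 (arXiv:1505.08165 pp. 10–11, 15);
[Castella2018] Thm. 3.1 (arXiv:1704.06608 p. 9); [LiuZhangZhang2018] Thm. 1.6, 1.8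
(arXiv:1511.08172 p. 5); [JetchevSkinnerWan2017] §7.4.1 (arXiv:1512.06894 p. 30).
-/

noncomputable section

open scoped Classical

open WeierstrassCurve NumberField IsDedekindDomain Field PowerSeries
  Literature.NumberTheory.EllipticCurves
  Literature.NumberTheory.EllipticCurves.ModularForms
  Literature.NumberTheory.EllipticCurves.GreenbergSelmer
  Literature.NumberTheory.EllipticCurves.Rank1Residual
  Literature.NumberTheory.EllipticCurves.Rank1Residual.Typed
  Summit.BirchSwinnertonDyer.Rank1Residual
  Summit.BirchSwinnertonDyer.Rank1Residual.X11b
  Summit.BirchSwinnertonDyer.Rank1Residual.X11b.AcSelmer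
  Summit.BirchSwinnertonDyer.Rank1Residual.X11b.Halves

-- D-0017 layout: summit = sub-problem, so `Summit.BirchSwinnertonDyer.BirchSwinnertonDyer.…` is the
-- mandated namespace (same option as the route's sockets files).
set_option linter.dupNamespace false

namespace Summit.BirchSwinnertonDyer.BirchSwinnertonDyer.Theorems.SchneiderFree

/-! ## The embedding-compatibility clause -/

/-- **`𝔭` is the prime of `K` induced by the embedding datum `ι' : ℚ̄_p ≃ ℂ`**: for every infinite
place `w` of `K` and every `k ∈ 𝓞 K`, `k ∈ 𝔭 ↔ ‖ι'⁻¹(w(k))‖ < 1` — verbatim the compatibility clause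
of the tree's named fact `castella2018_exists_isBDPLFunction` (the prime "induced by
`i_p = ι⁻¹ ∘ i_∞`" of Castella–Hsieh §3.3), for an arbitrary prime `p` (team x11b3's
`X11b.Three.InducesPrime` is the case `p = 3`). For an imaginary quadratic `K` it says
`𝔭 = primeOfEmbeddingDatum p ι' w₀.embedding` (`X11b/EmbeddingDatumPrime.lean`). A predicate with
parameters; nothing asserted. [cite: Castella2018, Thm. 3.1 (arXiv:1704.06608 p. 9)]
[cite: CastellaHsieh2018, §3.3 (arXiv:1505.08165 p. 9)] -/
def BranchInducesPrime (p : ℕ) [Fact p.Prime] {K : Type} [Field K] [NumberField K]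
    (ι' : PadicAlgCl p ≃+* ℂ) (𝔭 : HeightOneSpectrum (𝓞 K)) : Prop :=
  ∀ (w : InfinitePlace K) (k : 𝓞 K), k ∈ 𝔭.asIdeal ↔ ‖ι'.symm (w.embedding (k : K))‖ < 1

/-! ## The three typed halves of the additive socket (layer 2 of `PotMultBranchIMC` / `GordTwoBranchIMC`) -/

section Halves

variable (W : WeierstrassCurve ℚ) [W.IsElliptic] [W.IsGloballyMinimal] (p : ℕ) [Fact p.Prime]

/-- **H1 — a BDP-type frame EXISTS at the additive prime** (hypothesis-shaped). Over every datum of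
the socket `AdditiveIMCLowerBDPInputManinAt W p` (analytic rank one, the N10 locus, a Heegner field
`K` of odd discriminant with `p ∤ #𝓞_K^×`, ANY parametrisation datum `Dt` of level `N_E`, its traced
Heegner point `P` of infinite order) and every anticyclotomic frame `(κ, γ, 𝔭)` with `𝔭 ∣ p` of
degree one: an embedding datum `ι'` inducing `𝔭` and a frame `(Ω_K, Ω_p, L)`, `Ω_K ≠ 0`, `Ω_p ≠ 0`,
`L ∈ R₀⟦T⟧`, with the interpolation property `IsBDPLFunction ι' 𝔭 κ γ Dt.f Ω_K Ω_p L` for THE newform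
`Dt.f` of the datum (level `N_E`, `p² ∣ N_E`: Euler-type factor `1`). The period `Ω_p ∈ ℂ_p` is NOT
required to be a unit of `R₀`: the intended witness, Keller–Yin's `𝓛_ε = 𝓛_p(f̃)(χ_ε ·)`
(arXiv:2410.23241 §3.4) up to a unit of `Λ_{R₀}`, has Castella–Hsieh's multiplier
`ε(½, (ε_K ξ)_𝔭)^{-2}` (Prop. 3.6, arXiv:1505.08165 pp. 10–11) of `p`-adic size `p^{2n}`, absorbed
by `Ω_p ↦ Ω_p · p^{1/2}`. Content: Castella–Hsieh's CONSTRUCTION for `f̃` (`p ∤ N′`) on the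
`χ_ε`-branch plus `L(f̃/K, ε_K ξ, s) = L(f_E/K, ξ, s)` — a derivation, not a printed statement.
TYPED, not attempted; nothing asserted. [cite: CastellaHsieh2018, Def. 3.5 and Prop. 3.6 (arXiv:1505.08165 pp. 10–11) (shape only; nothing asserted)]
[cite: KellerYin2024b, §3.4 (arXiv:2410.23241 p. 19) (the branch `𝓛_ε`; preprint)] -/
@[conjecture]
def BranchBDPExistsAt : Prop :=
  ∀ (N : ℕ) [NeZero N] (K : Type) [Field K] [NumberField K]
    (Dt : ModularParametrizationData W N) (H : HeegnerDatum N (NumberField.discr K)) (ι : K →+* ℂ)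
    (P : (W.baseChange K).toAffine.Point),
    W.analyticRank = 1 → Additive.N10.Locus W p → W.conductorNorm ℤ = N → IsImaginaryQuadratic K →
    Odd (NumberField.discr K) → ¬ p ∣ Units.torsionOrder K → SatisfiesHeegnerHypothesis N K →
    (W.quadraticTwist (NumberField.discr K : ℚ)).entireLFunction 1 ≠ 0 →
    WeierstrassCurve.Affine.Point.map ι.toRatAlgHom P = heegnerPointComplex Dt H →
    ¬ IsOfFinAddOrder P →
    ∀ (κ : ZpExtension K p), κ.IsAnticyclotomic →
      ∀ (γ : Field.absoluteGaloisGroup K) [Fact (κ.IsTopGenerator γ)]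
        (𝔭 : HeightOneSpectrum (𝓞 K)), ((p : ℕ) : 𝓞 K) ∈ 𝔭.asIdeal →
        𝔭.asIdeal.ramificationIdx (𝓞 ℚ) = 1 → 𝔭.asIdeal.inertiaDeg (𝓞 ℚ) = 1 →
        ∃ ι' : PadicAlgCl p ≃+* ℂ, BranchInducesPrime p ι' 𝔭 ∧
          ∃ (ΩK : ℂ) (Ωp : ℂ_[p]) (L : UnrSeries p),
            ΩK ≠ 0 ∧ Ωp ≠ 0 ∧ IsBDPLFunction ι' 𝔭 κ γ Dt.f ΩK Ωp L

/-- **H3 — the branch main conjecture, "⊇" half, at the frame** (hypothesis-shaped; the door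
direction). Over the same data and frames: EVERY `L ∈ R₀⟦T⟧` with the interpolation property for
`(ι', 𝔭, κ, γ, Dt.f, Ω_K, Ω_p)` (`Ω_K ≠ 0`, `Ω_p ≠ 0`, `ι'` inducing `𝔭`) divides the base change of
the characteristic ideal of the constructed Greenberg/BDP module (strict at `𝔭`, relaxed at `𝔭̄`,
tree `XAc … ∅`): `Ch_Λ(X_ac^∅(E_K[p^∞]))·R₀⟦T⟧ ⊆ (L)` in `R₀⟦T⟧` (base change along
`toUnr p : ℤ_p → R₀`). On the (G-ord, `e = 2`) cell this is Keller–Yin's EQUALITY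
`Char_Λ(𝔛)Λ^{ur} = (𝓛_ε)` (Thm. 3.5.1: Case (I) `p ∤ N′`, `p` split, `p > 2`; their Greenberg Selmer
group, Def. 3.4.1, is relaxed at `v`, strict at `v̄` and at `w ∤ p` — the tree's shape with `𝔭 = v̄`)
read at such a frame — PREPRINT; on the (M) cell no divisibility is in print. All frames at one
`(ι', 𝔭, κ, γ, Dt.f)` differ by units of `Λ_{R₀}` whenever they exist, so the universal form is the
natural one (pattern of `X11b.Three.IMCDivAt₃`). TYPED, not attempted; nothing asserted.
[cite: KellerYin2024b, Def. 3.4.1, Prop. 3.4.4 and Thm. 3.5.1 (arXiv:2410.23241 pp. 19–20) (shape only; preprint)]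
[cite: Castella2018, §1 (1.b) and Thm. 2.3 (arXiv:1704.06608 pp. 3, 5) (shape only)] -/
@[conjecture]
def BranchIMCDivAt : Prop :=
  ∀ (N : ℕ) [NeZero N] (K : Type) [Field K] [NumberField K]
    (Dt : ModularParametrizationData W N) (H : HeegnerDatum N (NumberField.discr K)) (ι : K →+* ℂ)
    (P : (W.baseChange K).toAffine.Point),
    W.analyticRank = 1 → Additive.N10.Locus W p → W.conductorNorm ℤ = N → IsImaginaryQuadratic K →
    Odd (NumberField.discr K) → ¬ p ∣ Units.torsionOrder K → SatisfiesHeegnerHypothesis N K →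
    (W.quadraticTwist (NumberField.discr K : ℚ)).entireLFunction 1 ≠ 0 →
    WeierstrassCurve.Affine.Point.map ι.toRatAlgHom P = heegnerPointComplex Dt H →
    ¬ IsOfFinAddOrder P →
    ∀ (κ : ZpExtension K p), κ.IsAnticyclotomic →
      ∀ (γ : Field.absoluteGaloisGroup K) [Fact (κ.IsTopGenerator γ)]
        (𝔭 : HeightOneSpectrum (𝓞 K)), ((p : ℕ) : 𝓞 K) ∈ 𝔭.asIdeal →
        𝔭.asIdeal.ramificationIdx (𝓞 ℚ) = 1 → 𝔭.asIdeal.inertiaDeg (𝓞 ℚ) = 1 →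
        ∀ (ι' : PadicAlgCl p ≃+* ℂ), BranchInducesPrime p ι' 𝔭 →
          ∀ (ΩK : ℂ) (Ωp : ℂ_[p]) (L : UnrSeries p), ΩK ≠ 0 → Ωp ≠ 0 →
            IsBDPLFunction ι' 𝔭 κ γ Dt.f ΩK Ωp L →
              (XAc.charIdeal (W.baseChange K) p κ 𝔭 ∅ γ).map (PowerSeries.map (toUnr p)) ≤
                Ideal.span {L}

/-- **H2 — the value at the trivial character, Manin-robust, with an INTEGRAL cofactor**
(hypothesis-shaped). Over the same data and frames: EVERY `L` with the interpolation property for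
`(ι', 𝔭, κ, γ, Dt.f, Ω_K, Ω_p)` (`Ω_K ≠ 0`, `Ω_p ≠ 0`, `ι'` inducing `𝔭`) has value at the trivial
character `L(0) = u · (log_{ω_E} P / c)²` for some `u ∈ R₀` (integral — a unit is not needed for a
LOWER bound on Selmer), where `P` is THE Heegner point of the datum, `c = Dt.c` the constant of the
parametrisation (`c·Λ_f ⊆ Λ_E`, so `log_{ω_E} P = c · log_{ω_f} P`), and `log_{ω_E}` is read at THE
embedding `embAt K p 𝔭` of the degree-one prime. This is the BDP / `p`-adic Waldspurger value at 𝟙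
in the shape the receptacle `SchneiderFree.divisibilityLe_of_value_of_dvd` consumes; at an additive
prime `a_p(E) = 0`, so no factor `(1 − a_p p⁻¹ + ε_p)` appears. NOT IN PRINT at `p² ∣ N` against the
datum's `P`: Castella–Hsieh Thm. 4.8 needs conductor `p^n` with `n ≥ 2` (arXiv:1505.08165 p. 15),
BDP13 Thm. 5.13 conductor prime to `p`, and Keller–Yin's Heegner class (arXiv:2410.23241 §3.3,
p. 18: Castella–Hsieh's `z_{f̃, χ_ε, c}`) is the `χ_ε`-twisted conductor-`p` Heegner point of `Ẽ`,
whose index against `P` in `E(K) ⊗ ℤ_p` is a separate comparison. TYPED, not attempted; nothing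
asserted. [cite: BertoliniDarmonPrasanna2013, Thm. 5.13 (shape only; conductor prime to p)]
[cite: CastellaHsieh2018, Thm. 4.8 (arXiv:1505.08165 p. 15) (shape only; conductor p^n, n ≥ 2)]
[cite: JetchevSkinnerWan2017, §7.4.1 (arXiv:1512.06894 p. 30) (the Manin slack)] -/
@[conjecture]
def BranchBDPValueLeAt : Prop :=
  ∀ (N : ℕ) [NeZero N] (K : Type) [Field K] [NumberField K]
    (Dt : ModularParametrizationData W N) (H : HeegnerDatum N (NumberField.discr K)) (ι : K →+* ℂ)
    (P : (W.baseChange K).toAffine.Point),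
    W.analyticRank = 1 → Additive.N10.Locus W p → W.conductorNorm ℤ = N → IsImaginaryQuadratic K →
    Odd (NumberField.discr K) → ¬ p ∣ Units.torsionOrder K → SatisfiesHeegnerHypothesis N K →
    (W.quadraticTwist (NumberField.discr K : ℚ)).entireLFunction 1 ≠ 0 →
    WeierstrassCurve.Affine.Point.map ι.toRatAlgHom P = heegnerPointComplex Dt H →
    ¬ IsOfFinAddOrder P →
    ∀ (κ : ZpExtension K p), κ.IsAnticyclotomic →
      ∀ (γ : Field.absoluteGaloisGroup K) [Fact (κ.IsTopGenerator γ)]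
        (𝔭 : HeightOneSpectrum (𝓞 K)) (h𝔭 : ((p : ℕ) : 𝓞 K) ∈ 𝔭.asIdeal)
        (he : 𝔭.asIdeal.ramificationIdx (𝓞 ℚ) = 1) (hf : 𝔭.asIdeal.inertiaDeg (𝓞 ℚ) = 1),
        ∀ (ι' : PadicAlgCl p ≃+* ℂ), BranchInducesPrime p ι' 𝔭 →
          ∀ (ΩK : ℂ) (Ωp : ℂ_[p]) (L : UnrSeries p), ΩK ≠ 0 → Ωp ≠ 0 →
            IsBDPLFunction ι' 𝔭 κ γ Dt.f ΩK Ωp L →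
              ∃ u : unrIntegers p, L.HasValueAt 0 (((u : unrIntegers p) : ℂ_[p]) *
                (algebraMap ℚ_[p] ℂ_[p]
                  (logOmega W p (embAt K p 𝔭 h𝔭 he hf) P / (Dt.c : ℚ_[p]))) ^ 2)

end Halves

end Summit.BirchSwinnertonDyer.BirchSwinnertonDyer.Theorems.SchneiderFree

end
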